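import Summits.QuantumFields.BalabanUV.T4Continuum.Support.SubstrateAvgTowerRegularity
import Summits.QuantumFields.BalabanUV.T4Continuum.Support.SubstrateSecondOrderWindow
import Summits.QuantumFields.BalabanUV.T4Continuum.Support.B13ReadingsAvgTowerSecondUniform

/-!
# SUBSTRATE — W-28b (v2): the windowed `hloc` END on the FOUR-LETTER (α′, β′, β″, κ; κ₁)-WINDOW OF RECORD — NO `hbelow`

Cell `pub-balaban`, SUBSTRATE cell.  Summits-side under the LEAN PLACEMENT RULE.  Pure plumbing over W-25b `SubstrateAvgTowerRegularity` (§1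
`factorisationData_avgTower`, §2 `hloc_avgTower_on_levelWindow[_dom]` with (ℓ2) `hlipD` ∕ (ℓ4) `hbavgD` DISPLAYED), W-28a `SubstrateSecondOrderWindow` (`SecondOrderWindow`,
`fin_second_clause` — JUNCTION J-σ) and the NE5 owner's g40-σ FILE A `B13ReadingsAvgTowerSecondUniform` (p245329: `SecondOrderLetters` {`fin_second`, `corr_shift`} and the
END `hlipD_of_factorisation` = the (ℓ2) binder AT EVERY LEVEL with `βD := 2(β″ + 16β′²) + 8(κ₁ + 9κ(2β′ + 16κ))`; owner NOTE l.25382: β″ alone does NOT propagate below the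
finest level — the correction-SHIFT letter κ₁ does the work there).
§1 `secondOrderLetters_avgTower`: the owner's `SecondOrderLetters` INSTANTIATED at `S := towerOf P ι (axialTower V)`, `Cf := CfOf ι ℰ V`, `Kf := P.K` — `fin_second` := W-28a
`fin_second_clause` TOKEN FOR TOKEN (J-σ, BY NAME), `corr_shift` := the DISPLAYED κ₁ letter `hκ₁ : ∀ k < K, ‖CfOf k μ (τ_ν i) − CfOf k μ i‖ ≤ κ₁∕(lev L k)³` (σ-END's target, NE5 swarm
leaf-09-g20 `B13AvgCorrKappaOne`; its dist1-quotient display converts here in one line at instance time, like J-κ — NOT claimed in this file); `hlipD_avgTower` := the owner's END at the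
two data = W-25b §2's `hlipD` binder at every level, constant `βD` above.
§2 `hloc_avgTower_on_window4[_dom]`: W-25b §2's windowed `LocalRateOn` END RE-KEYED — IN: hα′, hβ′ ((3.35) shapes), hβ″ = `SecondOrderWindow P ι V β''` ((3.36) shape), hκ (SCALED
plaquette letter, J-κ), hκ₁ (correction-shift letter, J-σ′), `hbavgD` ((ℓ4) on `levelWindow K`, DISPLAYED until the owner's FILE B); OUT: `LocalRateOn (levelWindow K) (bgReadings (regClass (towerOf P ι
(avgTower ℰ V)))) C L⁻¹` with W-25b's constant at that `βD`.  SUPERSEDES the typer drafts v1 (f21528ed6056343d) ∕ v1.1 (8504ea40d38f6bdf), whose `hbelow` binder is gone.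

HONEST FRAMING: rung (B)+1 plumbing of the FINITE-VOLUME T⁴ programme — NOT infinite volume, NOT a mass gap, NOT Clay; spine PROVED 0∕9; NE5 ∕ NE2 NOT
PRINTED ∕ NOT PROVED; NO estimate is proved here (every letter is a hypothesis; nothing of Bałaban's is instantiated).  HONEST DEPENDENCY (cell line, verbatim):
continuum YM on T⁴ ⇐ BetaPertH ∧ nine spine estimates (0/9 proved); BetaPertH ⇐ (D1) ∧ (D4) ∧ CAP+tail; G-an2-4 gates asym, D1 and NE2/3/4.  0 sorry; axioms ⊆
{propext, Classical.choice, Quot.sound}.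
-/

noncomputable section

open scoped BigOperators Matrix Matrix.Norms.L2Operator

open Literature.MathematicalPhysics.QuantumFieldTheory.Balaban1983to89
open Literature.MathematicalPhysics.QuantumFieldTheory.Balaban1983to89.B5Prop11Plancherel (Tor fine)
open Literature.MathematicalPhysics.QuantumFieldTheory.Balaban1983to89.B5G183RateUnitTower (lev lev_neZero)
open Literature.MathematicalPhysics.QuantumFieldTheory.Balaban1983to89.BlockAveraging (corr)
open Summit.QuantumFields.BalabanUV.T4Continuum
open Summit.QuantumFields.BalabanUV.T4Continuum.BalabanAveragedTowerUnit (idx)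
open Summit.QuantumFields.BalabanUV.T4Continuum.NE2BalabanGauge (liftR)
open Summit.QuantumFields.BalabanUV.T4Continuum.SubstrateBackgroundTransporters (unitMod towerOf)
open Summit.QuantumFields.BalabanUV.T4Continuum.SubstrateLocalRateOn (LocalRateOn levelWindow)
open Summit.QuantumFields.BalabanUV.T4Continuum.BlockPairingGeometry (tau)
open Summit.QuantumFields.BalabanUV.T4Continuum.CovariantLinePlanting (bavg)
open Summit.QuantumFields.BalabanUV.T4Continuum.NE2FromNE3 (bgReadings)
open Summit.QuantumFields.BalabanUV.T4Continuum.RegularBackgroundTower (dconnTower regClass)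
open Summit.QuantumFields.BalabanUV.T4Continuum.SubstrateAvgTowerStructure (avgTower axialTower)
open Summit.QuantumFields.BalabanUV.T4Continuum.SubstrateAvgTowerPlumbing (towerOfS liftR_towerOfS)
open Summit.QuantumFields.BalabanUV.T4Continuum.SubstrateAvgTowerRegularity (hloc_avgTower_on_levelWindow)
open Summit.QuantumFields.BalabanUV.T4Continuum.SubstrateSecondOrderWindow (SecondOrderWindow fin_second_clause)
open Summit.QuantumFields.BalabanUV.T4Continuum.SubstrateAvgTowerFactorisation (CfOf stOf)
open Summit.QuantumFields.BalabanUV.T4Continuum.SubstrateAvgTowerRegularity (factorisationData_avgTower)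
open Summit.QuantumFields.BalabanUV.T4Continuum.B13ReadingsAvgTowerSecondUniform (SecondOrderLetters hlipD_of_factorisation)

namespace Summit.QuantumFields.BalabanUV.T4Continuum.SubstrateAvgTowerRegularitySecond

variable (P : Params) {G : Type*} [GaugeGroup G] {o : Type*} [Fintype o] [DecidableEq o] (ι : G →* Matrix o o ℂ) (ℰ : LoopAverage G)

/-! ## §1 The owner's `SecondOrderLetters` at the datum; (ℓ2) at every level -/

/-- [folklore] **THE OWNER's `SecondOrderLetters` INSTANTIATED AT THE AVERAGING TOWER OF RECORD** (`S := towerOf P ι (axialTower V)`, `Cf := CfOf ι ℰ V`, `Kf := P.K`):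
`fin_second` from the finest (3.36)-shape window (W-28a `fin_second_clause`, J-σ by name), `corr_shift` = the DISPLAYED κ₁ letter. -/
theorem secondOrderLetters_avgTower (V : GaugeField P 0 G) {β'' κ₁ : ℝ} (hβ''0 : 0 ≤ β'') (hβ'' : SecondOrderWindow P ι V β'')
    (hκ₁ : ∀ k < P.K, ∀ μ ν (i : idx P.L (unitMod P) k),
      ‖CfOf ι ℰ V k μ (tau (fine (lev P.L k) (unitMod P)) ν i) - CfOf ι ℰ V k μ i‖ ≤ κ₁ / ((lev P.L k : ℕ) : ℝ) ^ 3) :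
    SecondOrderLetters P.L (unitMod P) (towerOf P ι (axialTower V)) (CfOf ι ℰ V) P.K β'' κ₁ where
  fin_second _ hk μ ν ρ i₀ := fin_second_clause ι V hβ''0 hβ'' hk μ ν ρ i₀
  corr_shift := hκ₁

/-- [folklore] **(ℓ2) AT EVERY LEVEL FOR THE AVERAGING TOWER OF RECORD** — the owner's `hlipD_of_factorisation` at W-25b's `factorisationData_avgTower` and §1:
`‖dconnTower R k μ (τ_ν i) − dconnTower R k μ i‖ ≤ (2(β″ + 16β′²) + 8(κ₁ + 9κ(2β′ + 16κ)))∕lev L k` (`α′ ≤ 1∕16`, `κ ≤ 1∕64`, `2 ≤ L`). -/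
theorem hlipD_avgTower (hdist : ∀ g, ‖ι g - 1‖ = dist1 g) (hL : 2 ≤ P.L) (V : GaugeField P 0 G) {α' β' κ β'' κ₁ : ℝ}
    (hα0 : 0 ≤ α') (hα : α' ≤ 1 / 16) (hβ0 : 0 ≤ β') (hκ0 : 0 ≤ κ) (hκ1 : κ ≤ 1 / 64) (hβ''0 : 0 ≤ β'') (hκ₁0 : 0 ≤ κ₁)
    (hα' : ∀ b : PBond P 0, (P.L : ℝ) ^ P.K * dist1 (V b) ≤ α')
    (hβ' : ∀ (x : Site P 0) (ν μ : Fin P.d), (P.L : ℝ) ^ P.K * ‖ι (V ⟨x.shift μ, ν⟩) - ι (V ⟨x, ν⟩)‖ ≤ β' / (P.L : ℝ) ^ P.K)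
    (hβ'' : SecondOrderWindow P ι V β'')
    (hκ : ∀ (i k : ℕ), i + 1 + k = P.K → ∀ c : PBond P (i + 1), dist1 (corr ℰ (avgTower ℰ V i) c) * ((lev P.L k : ℕ) : ℝ) ^ 2 ≤ κ)
    (hκ₁ : ∀ k < P.K, ∀ μ ν (i : idx P.L (unitMod P) k),
      ‖CfOf ι ℰ V k μ (tau (fine (lev P.L k) (unitMod P)) ν i) - CfOf ι ℰ V k μ i‖ ≤ κ₁ / ((lev P.L k : ℕ) : ℝ) ^ 3) :
    ∀ k μ ν (i : idx P.L (unitMod P) k),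
      ‖dconnTower P.L (unitMod P) (towerOf P ι (avgTower ℰ V)) k μ (tau (fine (lev P.L k) (unitMod P)) ν i)
        - dconnTower P.L (unitMod P) (towerOf P ι (avgTower ℰ V)) k μ i‖ ≤ (2 * (β'' + 16 * β' ^ 2) + 8 * (κ₁ + 9 * κ * (2 * β' + 16 * κ))) / (lev P.L k : ℕ) :=
  fun k μ ν i =>
    hlipD_of_factorisation P.L (unitMod P) (factorisationData_avgTower P ι ℰ hdist V hα0 hβ0 hα' hβ' hκ)
      (secondOrderLetters_avgTower P ι ℰ V hβ''0 hβ'' hκ₁) hL hα0 hα hβ0 hβ''0 hκ0 hκ1 hκ₁0 k μ ν i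

/-! ## §2 The windowed `hloc` on the four-letter window of record -/

/-- [folklore] **THE WINDOWED `hloc` ON THE (α′, β′, β″, κ; κ₁)-WINDOW OF RECORD**: W-25b §2's `hloc_avgTower_on_levelWindow` with its (ℓ2) binder PRODUCED at every level by
§1 `hlipD_avgTower`; (ℓ4) `hbavgD` DISPLAYED (until the owner's FILE B). -/
theorem hloc_avgTower_on_window4 (hdist : ∀ g, ‖ι g - 1‖ = dist1 g) (hL : 2 ≤ P.L) (V : GaugeField P 0 G) {α' β' κ β'' κ₁ γD : ℝ}
    (hα0 : 0 ≤ α') (hα : α' ≤ 1 / 16) (hβ0 : 0 ≤ β') (hκ0 : 0 ≤ κ) (hκ1 : κ ≤ 1 / 64) (hβ''0 : 0 ≤ β'') (hκ₁0 : 0 ≤ κ₁)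
    (hα' : ∀ b : PBond P 0, (P.L : ℝ) ^ P.K * dist1 (V b) ≤ α')
    (hβ' : ∀ (x : Site P 0) (ν μ : Fin P.d), (P.L : ℝ) ^ P.K * ‖ι (V ⟨x.shift μ, ν⟩) - ι (V ⟨x, ν⟩)‖ ≤ β' / (P.L : ℝ) ^ P.K)
    (hβ'' : SecondOrderWindow P ι V β'')
    (hκ : ∀ (i k : ℕ), i + 1 + k = P.K → ∀ c : PBond P (i + 1), dist1 (corr ℰ (avgTower ℰ V i) c) * ((lev P.L k : ℕ) : ℝ) ^ 2 ≤ κ)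
    (hκ₁ : ∀ k < P.K, ∀ μ ν (i : idx P.L (unitMod P) k),
      ‖CfOf ι ℰ V k μ (tau (fine (lev P.L k) (unitMod P)) ν i) - CfOf ι ℰ V k μ i‖ ≤ κ₁ / ((lev P.L k : ℕ) : ℝ) ^ 3)
    (hbavgD : ∀ k ∈ levelWindow P.K, ∀ μ (y : idx P.L (unitMod P) k),
      ‖bavg (lev P.L k) P.L (unitMod P) (dconnTower P.L (unitMod P) (towerOf P ι (avgTower ℰ V)) (k + 1) μ) y
        - dconnTower P.L (unitMod P) (towerOf P ι (avgTower ℰ V)) k μ y‖ ≤ γD / (lev P.L k : ℕ)) :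
    LocalRateOn (levelWindow P.K) (bgReadings P.L (unitMod P) (regClass P.L (unitMod P) (towerOf P ι (avgTower ℰ V))))
      (max (κ * Real.exp (2 * α' + 8 * κ) + (2 * α' + 8 * κ) ^ 2 + (2 * P.d + 1) * (2 * β' + 16 * κ)) γD
        + 2 * P.d * max (2 * β' + 16 * κ) (2 * (β'' + 16 * β' ^ 2) + 8 * (κ₁ + 9 * κ * (2 * β' + 16 * κ))))
      ((P.L : ℝ)⁻¹) :=
  hloc_avgTower_on_levelWindow P ι ℰ hdist hL V hα0 hα hβ0 hκ0 hκ1 (by positivity) hα' hβ' hκ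
    (hlipD_avgTower P ι ℰ hdist hL V hα0 hα hβ0 hκ0 hκ1 hβ''0 hκ₁0 hα' hβ' hβ'' hκ hκ₁) hbavgD

/-- [folklore] … in the `∀ b ∈ dom` binder shape at `RgV b := towerOfS P ι (avgTower ℰ (fld b))` (W-25b `hloc_avgTower_on_levelWindow_dom`'s shape, re-keyed). -/
theorem hloc_avgTower_on_window4_dom (hdist : ∀ g, ‖ι g - 1‖ = dist1 g) (hL : 2 ≤ P.L) {BgD : Type*} {dom : Set BgD} (fld : BgD → GaugeField P 0 G)
    {α' β' κ β'' κ₁ γD : ℝ} (hα0 : 0 ≤ α') (hα : α' ≤ 1 / 16) (hβ0 : 0 ≤ β') (hκ0 : 0 ≤ κ) (hκ1 : κ ≤ 1 / 64) (hβ''0 : 0 ≤ β'') (hκ₁0 : 0 ≤ κ₁)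
    (hα' : ∀ b ∈ dom, ∀ c : PBond P 0, (P.L : ℝ) ^ P.K * dist1 (fld b c) ≤ α')
    (hβ' : ∀ b ∈ dom, ∀ (x : Site P 0) (ν μ : Fin P.d), (P.L : ℝ) ^ P.K * ‖ι (fld b ⟨x.shift μ, ν⟩) - ι (fld b ⟨x, ν⟩)‖ ≤ β' / (P.L : ℝ) ^ P.K)
    (hβ'' : ∀ b ∈ dom, SecondOrderWindow P ι (fld b) β'')
    (hκ : ∀ b ∈ dom, ∀ (i k : ℕ), i + 1 + k = P.K → ∀ c : PBond P (i + 1), dist1 (corr ℰ (avgTower ℰ (fld b) i) c) * ((lev P.L k : ℕ) : ℝ) ^ 2 ≤ κ)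
    (hκ₁ : ∀ b ∈ dom, ∀ k < P.K, ∀ μ ν (i : idx P.L (unitMod P) k),
      ‖CfOf ι ℰ (fld b) k μ (tau (fine (lev P.L k) (unitMod P)) ν i) - CfOf ι ℰ (fld b) k μ i‖ ≤ κ₁ / ((lev P.L k : ℕ) : ℝ) ^ 3)
    (hbavgD : ∀ b ∈ dom, ∀ k ∈ levelWindow P.K, ∀ μ (y : idx P.L (unitMod P) k),
      ‖bavg (lev P.L k) P.L (unitMod P) (dconnTower P.L (unitMod P) (towerOf P ι (avgTower ℰ (fld b))) (k + 1) μ) y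
        - dconnTower P.L (unitMod P) (towerOf P ι (avgTower ℰ (fld b))) k μ y‖ ≤ γD / (lev P.L k : ℕ)) :
    ∀ b ∈ dom, LocalRateOn (levelWindow P.K)
      (bgReadings P.L (unitMod P) (regClass P.L (unitMod P) (liftR P.L (unitMod P) (towerOfS P ι (avgTower ℰ (fld b))))))
      (max (κ * Real.exp (2 * α' + 8 * κ) + (2 * α' + 8 * κ) ^ 2 + (2 * P.d + 1) * (2 * β' + 16 * κ)) γD
        + 2 * P.d * max (2 * β' + 16 * κ) (2 * (β'' + 16 * β' ^ 2) + 8 * (κ₁ + 9 * κ * (2 * β' + 16 * κ))))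
      ((P.L : ℝ)⁻¹) := fun b hb => by
  rw [liftR_towerOfS]
  exact hloc_avgTower_on_window4 P ι ℰ hdist hL (fld b) hα0 hα hβ0 hκ0 hκ1 hβ''0 hκ₁0 (hα' b hb) (hβ' b hb) (hβ'' b hb) (hκ b hb) (hκ₁ b hb) (hbavgD b hb)

end Summit.QuantumFields.BalabanUV.T4Continuum.SubstrateAvgTowerRegularitySecond

end
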